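import Summits.CriticalPhenomena.PercolationContinuityZ3.Theorems.PercNearOneGluingNoHeavyLowerTailKnQuestion8CoefficientwiseCoreClassKernelMixDecor
import HarnessLib

/-!
# THEOREM OS-DECOR: the one-sided form is decoration-stable

Support file (`--supports stmt-CriticalPhenomena-4575`, closed), prover `prim-cplus-coupling` (gen 37).  No definitions, no notations, no named facts,
no sorries; standard axioms.  Memo `prim-cplus-coupling/A5-COUPLING-gen37.md` §5(a).  Companion of `…CoreClassKernelMixDecor` (THEOREM KB-DECOR, gen 35),
whose cluster identity `openCluster_union_decor` and Harris step `decor_harris_step` it reuses verbatim.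

Setting: `E, D` disjoint edge sets whose edges share no vertex other than `v`; terminals `a, b` on edges of `D` only if equal to `v`; colourings
`(ω, ε)` of `E ∪ D`; `X(ε) = C_v(ε)`; glued functions `φ_ε(Y) = φ(Y ∪ {w | v ∈ Y ∧ w ∈ X(ε)})`.  ONE-SIDED(E; a, b) (gen 36, contact at `a` allowed):
`Σ_ω h(C_a ω ∪ C_b ω)k(…) + Σ_{ω : b ∉ C_a ω} (hᵃ(C_a ω) − hᵇ(C_b(E∖ω)))(kᵃ(C_a ω) − kᵇ(C_b(E∖ω))) ≥ 0`.
* `Coefficientwise.coreClass_oneSided_decor` — **THEOREM OS-DECOR**: if ONE-SIDED(E; a, b) holds at the glued levels for every `ε ⊆ D`, then ONE-SIDED(E ∪ D; a, b)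
  holds at `(h, k; hᵃ, hᵇ; kᵃ, kᵇ)`.  Same proof as KB-DECOR: the one-sided index set `{b ∉ C_a}` of `E ∪ D` is `{b ∉ C_a} × 2^D` (the decoration never joins
  `a` to `b`), the supply is the sum of the glued supplies, and `decor_harris_step` turns the complementary gluing of the blue cluster into the same-`ε` gluing.
  Use (memo §5(a)): the 'conducting / mixed' classes of the long-arm Wheatstone bridges are ONE-SIDED forms of the cycle decorated by the tail of the mixed arm.
[cite: KozmaNitzan2024, Questions 8–9 (§5.5 p. 36) (context: the Question-8 pocket covariance programme)]
-/

namespace Summit.CriticalPhenomena.PercolationContinuityZ3.Theorems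

open Finset Literature.Probability.Percolation

namespace Coefficientwise

variable {ι V : Type*}

open Classical in
/-- **THEOREM OS-DECOR (the one-sided form is decoration-stable).**  `E, D` disjoint edge sets whose edges share no vertex other than `v`; the terminals
`a, b` lie on edges of `D` only if equal to `v`; monotone levels `hᵃ, hᵇ, kᵃ, kᵇ`.  Hypothesis: for every `ε ⊆ D`, ONE-SIDED(E; a, b) at the glued functions
`φ_ε(Y) = φ(Y ∪ {w | v ∈ Y ∧ w ∈ C_v(ε)})`:
`0 ≤ Σ_{ω ⊆ E} h_ε(S)k_ε(S) + Σ_{ω : b ∉ C_a ω} (hᵃ_ε(C_a ω) − hᵇ_ε(C_b(E∖ω)))(kᵃ_ε(C_a ω) − kᵇ_ε(C_b(E∖ω)))` (`S = C_a ω ∪ C_b ω`).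
Conclusion: ONE-SIDED(E ∪ D; a, b) at `(h, k; hᵃ, hᵇ; kᵃ, kᵇ)`. [cite: KozmaNitzan2024, Questions 8–9 (§5.5 p. 36) (context)] -/
theorem coreClass_oneSided_decor (ends : ι → Sym2 V) (E D : Finset ι) (v a b : V) (hED : Disjoint E D)
    (hsep : ∀ i ∈ E, ∀ j ∈ D, ∀ w, w ∈ ends i → w ∈ ends j → w = v)
    (haD : ∀ j ∈ D, a ∈ ends j → a = v) (hbD : ∀ j ∈ D, b ∈ ends j → b = v)
    (h k ha hb ka kb : Set V → ℝ) (mha : Monotone ha) (mhb : Monotone hb) (mka : Monotone ka) (mkb : Monotone kb)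
    (hmix : ∀ ε, ε ⊆ D → 0 ≤ (∑ ω ∈ E.powerset,
        h ((openCluster (ends '' (↑ω : Set ι)) a ∪ openCluster (ends '' (↑ω : Set ι)) b) ∪
            {w | v ∈ (openCluster (ends '' (↑ω : Set ι)) a ∪ openCluster (ends '' (↑ω : Set ι)) b) ∧ w ∈ openCluster (ends '' (↑ε : Set ι)) v}) *
          k ((openCluster (ends '' (↑ω : Set ι)) a ∪ openCluster (ends '' (↑ω : Set ι)) b) ∪
            {w | v ∈ (openCluster (ends '' (↑ω : Set ι)) a ∪ openCluster (ends '' (↑ω : Set ι)) b) ∧ w ∈ openCluster (ends '' (↑ε : Set ι)) v}))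
      + ∑ ω ∈ E.powerset.filter (fun ω : Finset ι => b ∉ openCluster (ends '' (↑ω : Set ι)) a),
        (ha (openCluster (ends '' (↑ω : Set ι)) a ∪ {w | v ∈ openCluster (ends '' (↑ω : Set ι)) a ∧ w ∈ openCluster (ends '' (↑ε : Set ι)) v})
          - hb (openCluster (ends '' (↑(E \ ω) : Set ι)) b ∪ {w | v ∈ openCluster (ends '' (↑(E \ ω) : Set ι)) b ∧ w ∈ openCluster (ends '' (↑ε : Set ι)) v})) *
        (ka (openCluster (ends '' (↑ω : Set ι)) a ∪ {w | v ∈ openCluster (ends '' (↑ω : Set ι)) a ∧ w ∈ openCluster (ends '' (↑ε : Set ι)) v})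
          - kb (openCluster (ends '' (↑(E \ ω) : Set ι)) b ∪ {w | v ∈ openCluster (ends '' (↑(E \ ω) : Set ι)) b ∧ w ∈ openCluster (ends '' (↑ε : Set ι)) v}))) :
    0 ≤ (∑ ω ∈ (E ∪ D).powerset,
        h (openCluster (ends '' (↑ω : Set ι)) a ∪ openCluster (ends '' (↑ω : Set ι)) b) *
          k (openCluster (ends '' (↑ω : Set ι)) a ∪ openCluster (ends '' (↑ω : Set ι)) b))
      + ∑ ω ∈ (E ∪ D).powerset.filter (fun ω : Finset ι => b ∉ openCluster (ends '' (↑ω : Set ι)) a),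
        (ha (openCluster (ends '' (↑ω : Set ι)) a) - hb (openCluster (ends '' (↑((E ∪ D) \ ω) : Set ι)) b)) *
          (ka (openCluster (ends '' (↑ω : Set ι)) a) - kb (openCluster (ends '' (↑((E ∪ D) \ ω) : Set ι)) b)) := by
  set C : Finset ι → V → Set V := fun ω x => openCluster (ends '' (↑ω : Set ι)) x with hC
  set Sg : Finset ι → Finset ι → Set V := fun ω ε => (C ω a ∪ C ω b) ∪ {w | v ∈ (C ω a ∪ C ω b) ∧ w ∈ C ε v} with hSg
  set Fa : Finset ι → Finset ι → ℝ := fun ω ε => ha (C ω a ∪ {w | v ∈ C ω a ∧ w ∈ C ε v}) with hFa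
  set Ka : Finset ι → Finset ι → ℝ := fun ω ε => ka (C ω a ∪ {w | v ∈ C ω a ∧ w ∈ C ε v}) with hKa
  set Gb : Finset ι → Finset ι → ℝ := fun ω ε => hb (C (E \ ω) b ∪ {w | v ∈ C (E \ ω) b ∧ w ∈ C ε v}) with hGb
  set Kb : Finset ι → Finset ι → ℝ := fun ω ε => kb (C (E \ ω) b ∪ {w | v ∈ C (E \ ω) b ∧ w ∈ C ε v}) with hKb
  set TE : Finset (Finset ι) := E.powerset.filter (fun ω : Finset ι => b ∉ C ω a) with hTE
  change ∀ ε, ε ⊆ D → 0 ≤ (∑ ω ∈ E.powerset, h (Sg ω ε) * k (Sg ω ε))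
      + ∑ ω ∈ TE, (Fa ω ε - Gb ω ε) * (Ka ω ε - Kb ω ε) at hmix
  change 0 ≤ (∑ ω ∈ (E ∪ D).powerset, h (C ω a ∪ C ω b) * k (C ω a ∪ C ω b))
      + ∑ ω ∈ (E ∪ D).powerset.filter (fun ω : Finset ι => b ∉ C ω a),
        (ha (C ω a) - hb (C ((E ∪ D) \ ω) b)) * (ka (C ω a) - kb (C ((E ∪ D) \ ω) b))
  -- (F1) clusters of the decorated graph
  have hclu : ∀ ω ε, ω ⊆ E → ε ⊆ D → ∀ x, (∀ j ∈ D, x ∈ ends j → x = v) →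
      C (ω ∪ ε) x = C ω x ∪ {w | v ∈ C ω x ∧ w ∈ C ε v} :=
    fun ω ε hω hε x hx => openCluster_union_decor ends E D ω ε v x hsep hx hω hε
  -- (F2) complements split
  have hsd : ∀ ω ε, ω ⊆ E → ε ⊆ D → (E ∪ D) \ (ω ∪ ε) = (E \ ω) ∪ (D \ ε) :=
    fun ω ε hω hε => sdiff_union_sdiff E D ω ε hED hω hε
  -- (F3) the one-sided index set does not see the decoration
  have hwall1 : ∀ ω ε, ω ⊆ E → ε ⊆ D → (b ∈ C (ω ∪ ε) a ↔ b ∈ C ω a) := by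
    intro ω ε hω hε
    rw [hclu ω ε hω hε a haD]
    constructor
    · rintro (hb1 | ⟨hv, hbv⟩)
      · exact hb1
      · by_cases hbv' : b = v
        · rw [hbv']; exact hv
        · obtain ⟨j, hj, hbj⟩ := exists_edge_of_mem_openCluster ends hbv hbv'
          exact absurd (hbD j (hε hj) hbj) hbv'
    · intro hb1; exact Or.inl hb1
  -- Step A: the supply of `E ∪ D` is the sum of the glued supplies
  have hsetS : ∀ ω ε, ω ⊆ E → ε ⊆ D → C (ω ∪ ε) a ∪ C (ω ∪ ε) b = Sg ω ε := by
    intro ω ε hω hε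
    rw [hclu ω ε hω hε a haD, hclu ω ε hω hε b hbD]
    ext w; simp only [hSg, Set.mem_union, Set.mem_setOf_eq]; tauto
  have hA : ∑ ω ∈ (E ∪ D).powerset, h (C ω a ∪ C ω b) * k (C ω a ∪ C ω b) =
      ∑ ε ∈ D.powerset, ∑ ω ∈ E.powerset, h (Sg ω ε) * k (Sg ω ε) := by
    rw [sum_powerset_union_disjoint hED, Finset.sum_comm]
    refine Finset.sum_congr rfl fun ε hε => Finset.sum_congr rfl fun ω hω => ?_
    rw [hsetS ω ε (Finset.mem_powerset.mp hω) (Finset.mem_powerset.mp hε)]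
  -- Step B: the one-sided sum of `E ∪ D` in glued coordinates
  have hB : ∑ ω ∈ (E ∪ D).powerset.filter (fun ω : Finset ι => b ∉ C ω a),
        (ha (C ω a) - hb (C ((E ∪ D) \ ω) b)) * (ka (C ω a) - kb (C ((E ∪ D) \ ω) b)) =
      ∑ ω ∈ TE, ∑ ε ∈ D.powerset, (Fa ω ε - Gb ω (D \ ε)) * (Ka ω ε - Kb ω (D \ ε)) := by
    rw [Finset.sum_filter, sum_powerset_union_disjoint hED, hTE, Finset.sum_filter]
    refine Finset.sum_congr rfl fun ω hω => ?_
    have hωE : ω ⊆ E := Finset.mem_powerset.mp hω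
    by_cases hw : b ∉ C ω a
    · rw [if_pos hw]
      refine Finset.sum_congr rfl fun ε hε => ?_
      have hεD : ε ⊆ D := Finset.mem_powerset.mp hε
      have hw' : b ∉ C (ω ∪ ε) a := fun hx => hw ((hwall1 ω ε hωE hεD).mp hx)
      rw [if_pos hw', hsd ω ε hωE hεD, hclu ω ε hωE hεD a haD,
        hclu (E \ ω) (D \ ε) Finset.sdiff_subset Finset.sdiff_subset b hbD]
    · rw [if_neg hw]
      refine Finset.sum_eq_zero fun ε hε => ?_
      have hεD : ε ⊆ D := Finset.mem_powerset.mp hε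
      rw [if_neg (fun h' => hw (fun hx => h' ((hwall1 ω ε hωE hεD).mpr hx)))]
  -- Step C: the hypotheses, summed over the colourings of the decoration
  have hCsum : 0 ≤ (∑ ε ∈ D.powerset, ∑ ω ∈ E.powerset, h (Sg ω ε) * k (Sg ω ε))
      + ∑ ω ∈ TE, ∑ ε ∈ D.powerset, (Fa ω ε - Gb ω ε) * (Ka ω ε - Kb ω ε) := by
    have h1 : 0 ≤ ∑ ε ∈ D.powerset, ((∑ ω ∈ E.powerset, h (Sg ω ε) * k (Sg ω ε))
        + ∑ ω ∈ TE, (Fa ω ε - Gb ω ε) * (Ka ω ε - Kb ω ε)) :=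
      Finset.sum_nonneg fun ε hε => hmix ε (Finset.mem_powerset.mp hε)
    rw [Finset.sum_add_distrib] at h1
    rw [Finset.sum_comm (s := TE)]
    exact h1
  -- Step D: Harris on the decoration, index colouring by index colouring
  have hmonoX : ∀ {ε ε' : Finset ι}, ε ≤ ε' → C ε v ⊆ C ε' v := fun hle => openCluster_image_mono ends hle v
  have hglue_mono : ∀ (Y : Set V) {ε ε' : Finset ι}, ε ≤ ε' →
      Y ∪ {w | v ∈ Y ∧ w ∈ C ε v} ⊆ Y ∪ {w | v ∈ Y ∧ w ∈ C ε' v} := by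
    intro Y ε ε' hle w hw
    rcases hw with hw | ⟨hv, hw⟩
    · exact Or.inl hw
    · exact Or.inr ⟨hv, hmonoX hle hw⟩
  have hD : ∑ ω ∈ TE, ∑ ε ∈ D.powerset, (Fa ω ε - Gb ω ε) * (Ka ω ε - Kb ω ε) ≤
      ∑ ω ∈ TE, ∑ ε ∈ D.powerset, (Fa ω ε - Gb ω (D \ ε)) * (Ka ω ε - Kb ω (D \ ε)) := by
    refine Finset.sum_le_sum fun ω _ => ?_
    exact decor_harris_step D (Fa ω) (Ka ω) (Gb ω) (Kb ω)
      (fun ε ε' hle => mha (hglue_mono _ hle)) (fun ε ε' hle => mka (hglue_mono _ hle))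
      (fun ε ε' hle => mhb (hglue_mono _ hle)) (fun ε ε' hle => mkb (hglue_mono _ hle))
  rw [hA, hB]
  linarith

end Coefficientwise

end Summit.CriticalPhenomena.PercolationContinuityZ3.Theorems
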